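import Mathlib.Analysis.InnerProductSpace.PiL2
import Mathlib.Analysis.Calculus.DerivativeTest
import Mathlib.Analysis.Calculus.FDeriv.Symmetric
import Mathlib.Analysis.Calculus.ContDiff.RCLike
import Mathlib.Analysis.Matrix.Order
import HarnessLib

/-!
# Lemmas for E. Hopf's strong minimum principle, I: the classical minimum principle at a point

Pointwise ingredients of the proof of the minimum principle of E. Hopf (López-Gómez, *Linear
Second Order Elliptic Operators*, 2012, Ch. 1, Thm. 1.1 and Thm. 1.2):

* `deriv_deriv_nonneg_of_isLocalMin`, `fderiv_fderiv_nonneg_of_isLocalMin` — the second-order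
  necessary condition at a local minimum (`D²u(x₀)(v, v) ≥ 0`);
* `sum_mul_nonneg_of_posSemidef` — `∑ᵢⱼ aᵢⱼ Hᵢⱼ ≥ 0` for positive semidefinite symmetric
  `a`, `H` (Schur; via Mathlib's `Matrix.PosSemidef.hadamard`);
* `linearOp_nonpos_at_isLocalMin` — **Thm. 1.1 in pointwise form**: at a non-positive local
  minimum `x` of a `C²` function `w`, `-∑ aᵢⱼ ∂ᵢⱼw(x) + ∑ bᵢ ∂ᵢw(x) + c w(x) ≤ 0` whenever
  `(aᵢⱼ)` is symmetric positive semidefinite and `c ≥ 0`.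

Partial derivatives are written out as Fréchet derivatives in the coordinate directions
`eᵢ = EuclideanSpace.single i 1` (`∂ᵢw(x) = Dw(x) eᵢ`, `∂ᵢⱼw(x) = D(Dw)(x) eᵢ eⱼ`), i.e. the
tree's `Literature.Analysis.FluidPDE.pderiv i w x` (`FluidPDE/CoordDerivatives.lean`) and the
Hessian entry `hessianEntry w i j x` of `QuasilinearMaximumPrinciple.lean` unfolded, so that this
file depends on neither.

## References

* J. López-Gómez, *Linear Second Order Elliptic Operators*, World Scientific (2012; © 2013), Ch. 1,
  Thm. 1.1 (classical minimum principle) and its proof.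
* D. Gilbarg, N. S. Trudinger, *Elliptic Partial Differential Equations of Second Order*,
  Springer 2001, §3.1.
-/

noncomputable section

open Set Filter Topology Matrix

namespace Literature.Analysis.PDE

/-! ### Second-order necessary condition at a local minimum -/

/-- At a local minimum of a real function continuous there, Mathlib's second derivative
`deriv (deriv φ) t₀` is non-negative (no differentiability needed: if it were negative, the
second-derivative test would make `t₀` also a local maximum, so `φ` would be locally constant and
the second derivative would vanish). [folklore] -/
theorem deriv_deriv_nonneg_of_isLocalMin {φ : ℝ → ℝ} {t₀ : ℝ} (h : IsLocalMin φ t₀)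
    (hc : ContinuousAt φ t₀) : 0 ≤ deriv (deriv φ) t₀ := by
  by_contra hneg
  rw [not_le] at hneg
  have hmax : IsLocalMax φ t₀ := isLocalMax_of_deriv_deriv_neg hneg h.deriv_eq_zero hc
  have hconst : φ =ᶠ[𝓝 t₀] fun _ ↦ φ t₀ := by
    filter_upwards [h, hmax] with t h1 h2 using le_antisymm h2 h1
  have h1 : deriv φ =ᶠ[𝓝 t₀] fun _ ↦ (0 : ℝ) := by
    filter_upwards [hconst.deriv] with t ht
    rw [ht, deriv_const]
  have h2 : deriv (deriv φ) t₀ = 0 := by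
    rw [h1.deriv_eq, deriv_const]
  linarith

/-- **Second-order necessary condition at a local minimum.** If `u : E → ℝ` is `C²` at a local
minimum `x₀`, then `D²u(x₀)(v, v) ≥ 0` for every `v` (restrict to the line `t ↦ x₀ + t v`).
[folklore] -/
theorem fderiv_fderiv_nonneg_of_isLocalMin {E : Type*} [NormedAddCommGroup E] [NormedSpace ℝ E]
    {u : E → ℝ} {x₀ : E} (h : IsLocalMin u x₀) (hu : ContDiffAt ℝ 2 u x₀) (v : E) :
    0 ≤ fderiv ℝ (fderiv ℝ u) x₀ v v := by
  -- the line through `x₀` in direction `v`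
  set γ : ℝ → E := fun t ↦ x₀ + t • v with hγ_def
  have hγ : ∀ t, HasDerivAt γ v t := fun t ↦ by
    simpa [hγ_def] using ((hasDerivAt_id t).smul_const v).const_add x₀
  have hγ0 : γ 0 = x₀ := by simp [hγ_def]
  set φ : ℝ → ℝ := u ∘ γ with hφ_def
  -- `u` is differentiable near `x₀`, `Du` is differentiable at `x₀`
  have hev : ∀ᶠ y in 𝓝 x₀, DifferentiableAt ℝ u y := by
    filter_upwards [hu.eventually (by simp)] with y hy
    exact hy.differentiableAt (by simp)
  have hD : DifferentiableAt ℝ (fderiv ℝ u) x₀ :=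
    (hu.fderiv_right (m := 1) (by norm_num)).differentiableAt one_ne_zero
  -- first derivative of the slice near `0`
  have hφ' : deriv φ =ᶠ[𝓝 0] fun t ↦ fderiv ℝ u (γ t) v := by
    have : ∀ᶠ t in 𝓝 (0 : ℝ), DifferentiableAt ℝ u (γ t) := by
      have hcont : ContinuousAt γ 0 := (hγ 0).continuousAt
      rw [← hγ0] at hev
      exact hcont.eventually hev
    filter_upwards [this] with t ht
    exact (ht.hasFDerivAt.comp_hasDerivAt t (hγ t)).deriv
  -- second derivative of the slice at `0`
  have hφ'' : deriv (deriv φ) 0 = fderiv ℝ (fderiv ℝ u) x₀ v v := by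
    rw [hφ'.deriv_eq]
    have hD' : DifferentiableAt ℝ (fderiv ℝ u) (γ 0) := by rw [hγ0]; exact hD
    have h1 : HasDerivAt (fderiv ℝ u ∘ γ) (fderiv ℝ (fderiv ℝ u) (γ 0) v) 0 :=
      hD'.hasFDerivAt.comp_hasDerivAt 0 (hγ 0)
    rw [hγ0] at h1
    have h2 := h1.clm_apply (hasDerivAt_const (0 : ℝ) v)
    simp only [ContinuousLinearMap.map_zero] at h2
    simpa using h2.deriv
  have hmin : IsLocalMin φ 0 := by
    have : IsLocalMin u (γ 0) := by rwa [hγ0]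
    exact this.comp_continuous (hγ 0).continuousAt
  have hcont : ContinuousAt φ 0 := by
    have : ContinuousAt u (γ 0) := by rw [hγ0]; exact hu.continuousAt
    exact this.comp (hγ 0).continuousAt
  rw [← hφ'']
  exact deriv_deriv_nonneg_of_isLocalMin hmin hcont

/-! ### A trace inequality -/

/-- **Schur / Fejér.** If `a` and `H` are symmetric and positive semidefinite
(`∑ᵢⱼ aᵢⱼ ξᵢ ξⱼ ≥ 0`, `∑ᵢⱼ Hᵢⱼ ξᵢ ξⱼ ≥ 0` for all `ξ`), then `∑ᵢⱼ aᵢⱼ Hᵢⱼ ≥ 0` (the Hadamard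
product is positive semidefinite, Mathlib's `Matrix.PosSemidef.hadamard`, tested on the vector
`(1, …, 1)`). López-Gómez 2012, proof of Thm. 1.1 (there via diagonalisation, Prop. 1.1).
[cite: LopezGomez2012, Thm. 1.1 (proof) and Prop. 1.1] -/
theorem sum_mul_nonneg_of_posSemidef {N : ℕ} {a H : Fin N → Fin N → ℝ}
    (ha_symm : ∀ i j, a i j = a j i) (ha : ∀ ξ : Fin N → ℝ, 0 ≤ ∑ i, ∑ j, a i j * ξ i * ξ j)
    (hH_symm : ∀ i j, H i j = H j i) (hH : ∀ ξ : Fin N → ℝ, 0 ≤ ∑ i, ∑ j, H i j * ξ i * ξ j) :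
    0 ≤ ∑ i, ∑ j, a i j * H i j := by
  have key : ∀ {M : Fin N → Fin N → ℝ}, (∀ i j, M i j = M j i) →
      (∀ ξ : Fin N → ℝ, 0 ≤ ∑ i, ∑ j, M i j * ξ i * ξ j) → (Matrix.of M).PosSemidef := by
    intro M hsymm hpos
    refine Matrix.PosSemidef.of_dotProduct_mulVec_nonneg ?_ fun x ↦ ?_
    · ext i j
      simpa [Matrix.conjTranspose_apply] using hsymm j i
    · have : star x ⬝ᵥ (Matrix.of M *ᵥ x) = ∑ i, ∑ j, M i j * x i * x j := by
        simp only [dotProduct, Matrix.mulVec, Matrix.of_apply, star_trivial, Finset.mul_sum]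
        refine Finset.sum_congr rfl fun i _ ↦ Finset.sum_congr rfl fun j _ ↦ ?_
        ring
      rw [this]
      exact hpos x
  have hAH := (key ha_symm ha).hadamard (key hH_symm hH)
  have := hAH.dotProduct_mulVec_nonneg fun _ ↦ 1
  simpa [dotProduct, Matrix.mulVec, Matrix.hadamard, Matrix.of_apply] using this

/-! ### The classical minimum principle at a point (López-Gómez Thm. 1.1) -/

/-- **Classical minimum principle, pointwise form** (López-Gómez 2012, Thm. 1.1 and its proof):
let `w` be `C²` at a local minimum `x` with `w(x) ≤ 0`, let `(aᵢⱼ)` be symmetric positive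
semidefinite and `c ≥ 0`. Then
`𝔏w(x) = -∑ᵢⱼ aᵢⱼ ∂ᵢⱼw(x) + ∑ᵢ bᵢ ∂ᵢw(x) + c w(x) ≤ 0` — the gradient vanishes, the Hessian is
positive semidefinite, so `∑ aᵢⱼ∂ᵢⱼw ≥ 0`, and `c w(x) ≤ 0`. (Thm. 1.1 states the
contrapositive: if `𝔏w > 0` then `w` has no non-positive local minimum.) Here
`∂ᵢw = Dw(eᵢ)`, `∂ᵢⱼw = D(Dw)(eᵢ)(eⱼ)`, `eᵢ = EuclideanSpace.single i 1`.
[cite: LopezGomez2012, Thm. 1.1] -/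
theorem linearOp_nonpos_at_isLocalMin {N : ℕ} {w : EuclideanSpace ℝ (Fin N) → ℝ}
    {x : EuclideanSpace ℝ (Fin N)} {a : Fin N → Fin N → ℝ} (b : Fin N → ℝ) {c : ℝ}
    (ha_symm : ∀ i j, a i j = a j i)
    (ha : ∀ ξ : Fin N → ℝ, 0 ≤ ∑ i, ∑ j, a i j * ξ i * ξ j) (hc : 0 ≤ c)
    (hw : ContDiffAt ℝ 2 w x) (hmin : IsLocalMin w x) (hwx : w x ≤ 0) :
    -(∑ i, ∑ j, a i j * fderiv ℝ (fderiv ℝ w) x (EuclideanSpace.single i 1)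
        (EuclideanSpace.single j 1)) +
      ∑ i, b i * fderiv ℝ w x (EuclideanSpace.single i 1) + c * w x ≤ 0 := by
  -- the gradient vanishes
  have hgrad : fderiv ℝ w x = 0 := hmin.fderiv_eq_zero
  -- the Hessian is symmetric and positive semidefinite
  have hHsymm : ∀ i j, fderiv ℝ (fderiv ℝ w) x (EuclideanSpace.single i 1)
      (EuclideanSpace.single j 1) = fderiv ℝ (fderiv ℝ w) x (EuclideanSpace.single j 1)
      (EuclideanSpace.single i 1) := fun i j ↦
    hw.isSymmSndFDerivAt (by simp) _ _
  have hHpos : ∀ ξ : Fin N → ℝ, 0 ≤ ∑ i, ∑ j, fderiv ℝ (fderiv ℝ w) x (EuclideanSpace.single i 1)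
      (EuclideanSpace.single j 1) * ξ i * ξ j := by
    intro ξ
    have h2 := fderiv_fderiv_nonneg_of_isLocalMin hmin hw (∑ i, ξ i • EuclideanSpace.single i (1 : ℝ))
    have hexp : fderiv ℝ (fderiv ℝ w) x (∑ i, ξ i • EuclideanSpace.single i (1 : ℝ))
        (∑ i, ξ i • EuclideanSpace.single i (1 : ℝ)) = ∑ i, ∑ j, fderiv ℝ (fderiv ℝ w) x
        (EuclideanSpace.single i 1) (EuclideanSpace.single j 1) * ξ i * ξ j := by
      simp only [map_sum, map_smul, FunLike.coe_sum, FunLike.coe_smul,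
        Finset.sum_apply, Pi.smul_apply, smul_eq_mul, Finset.mul_sum]
      refine Finset.sum_congr rfl fun i _ ↦ Finset.sum_congr rfl fun j _ ↦ ?_
      rw [hHsymm i j]
      ring
    rwa [hexp] at h2
  have hsum := sum_mul_nonneg_of_posSemidef (H := fun i j ↦ fderiv ℝ (fderiv ℝ w) x
    (EuclideanSpace.single i 1) (EuclideanSpace.single j 1)) ha_symm ha hHsymm hHpos
  beta_reduce at hsum
  have hcw : c * w x ≤ 0 := mul_nonpos_of_nonneg_of_nonpos hc hwx
  simp only [hgrad, _root_.zero_apply, mul_zero, Finset.sum_const_zero, add_zero]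
  linarith

end Literature.Analysis.PDE

end
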